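import Literature.MathematicalPhysics.KineticTheory.HardSphereCanonicalTorus
import HarnessLib

/-!
# Hard-sphere local density approximation, Ia: convexity of the finite-volume canonical free energy

Helper file for the support item `HardSphereLDA` (stmt-AtomisticToContinuum-13459) of route
`JaynesSqueeze` (`Summit.AtomisticToContinuum.HydrodynamicLimit.Theses.JaynesSqueeze.HardSphereLDA`).

For `n` hard spheres of diameter `ε` on `𝕋³` in the external field `log a` (measurable activity
`0 ≤ a ≤ A`) the configurational partition function is `Z(a) = posPartition a ε n =
∫ 𝟙_{no overlap}(x) ∏ᵢ a(xᵢ) dx` (`HardSphereEulerProofs`). This file proves the first finite-volume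
inequality on which the local density approximation of the item is built:

* `log_posPartition_tilt_ge` — **convexity (Jensen)**: tilting the activity by `e^ψ`,
  `log Z(a e^ψ) − log Z(a) ≥ E_a[∑ᵢ ψ(xᵢ)]`, where `E_a` is the canonical Gibbs expectation
  `Z(a)⁻¹ ∫ 𝟙 ∏ a(xᵢ) (·) dx` (from `1 + t ≤ eᵗ`, `mul_exp_le_integral_mul_exp`; no abstract Jensen
  inequality is invoked).

Companions: `JaynesSqueezeHardSphereLDAInsertion` (the one-point insertion bound) and
`JaynesSqueezeHardSphereLDAStability` (`L¹`-stability of `log Z` in the field).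
No definitions. prover-pitem-stmt-AtomisticToContinuum-13459-0.
-/

noncomputable section

namespace Summit.AtomisticToContinuum.HydrodynamicLimit.Theorems.HardSphereLDA

open MeasureTheory Filter Set Topology
open scoped ENNReal
open Literature.MathematicalPhysics.KineticTheory Literature.Analysis.FluidPDE

/-! ### Bounded measurable functions on the configuration torus -/

/-- A bounded measurable real function of the configuration is integrable (the configuration
torus has finite volume; Mathlib's `Integrable.of_bound`). [folklore] -/
theorem integrable_config_of_abs_le {n : ℕ} {f : (Fin n → T3) → ℝ} (hf : Measurable f) {K : ℝ}
    (hK : ∀ x, |f x| ≤ K) : Integrable f :=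
  Integrable.of_bound hf.aestronglyMeasurable K (Eventually.of_forall fun x =>
    (Real.norm_eq_abs _).trans_le (hK x))

/-- A bounded measurable real function on `𝕋³` is integrable (Mathlib's `Integrable.of_bound`).
[folklore] -/
theorem integrable_T3_of_abs_le {f : T3 → ℝ} (hf : Measurable f) {K : ℝ} (hK : ∀ x, |f x| ≤ K) :
    Integrable f :=
  Integrable.of_bound hf.aestronglyMeasurable K (Eventually.of_forall fun x =>
    (Real.norm_eq_abs _).trans_le (hK x))

variable {a : T3 → ℝ} {ε : ℝ} {n : ℕ}

-- adapted from `BlockGibbsLine.measurable_posWeight'` (kept local to keep the imports of this file light)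
/-- The position weight of a measurable activity is measurable. [folklore] -/
theorem measurable_posWeight_of_measurable (ha : Measurable a) (ε : ℝ) (n : ℕ) :
    Measurable (posWeight a ε n) :=
  (Finset.measurable_prod _ fun i _ => ha.comp (measurable_pi_apply i)).indicator
    (measurableSet_posDomain ε n)

/-- `|posWeight a ε n x| ≤ Aⁿ` for `0 ≤ a ≤ A`. [folklore] -/
theorem abs_posWeight_le (ha0 : ∀ y, 0 ≤ a y) {A : ℝ} (hA : ∀ y, a y ≤ A) (ε : ℝ) (x : Fin n → T3) :
    |posWeight a ε n x| ≤ A ^ n := by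
  rw [abs_of_nonneg (posWeight_nonneg ha0 ε x)]
  exact posWeight_le_pow ha0 hA ε x

/-- The one-body sum `∑ᵢ ψ(xᵢ)` is measurable in the configuration. [folklore] -/
theorem measurable_sum_apply {ψ : T3 → ℝ} (hψ : Measurable ψ) :
    Measurable fun x : Fin n → T3 => ∑ i, ψ (x i) :=
  Finset.measurable_sum _ fun i _ => hψ.comp (measurable_pi_apply i)

/-- `|∑ᵢ ψ(xᵢ)| ≤ n C` for `|ψ| ≤ C`. [folklore] -/
theorem abs_sum_apply_le' {ψ : T3 → ℝ} {C : ℝ} (hψC : ∀ y, |ψ y| ≤ C) (x : Fin n → T3) :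
    |∑ i, ψ (x i)| ≤ n * C := by
  calc |∑ i, ψ (x i)| ≤ ∑ i, |ψ (x i)| := Finset.abs_sum_le_sum_abs _ _
    _ ≤ ∑ _i : Fin n, C := Finset.sum_le_sum fun i _ => hψC _
    _ = n * C := by simp

/-- The configurational partition function of a measurable activity `0 ≤ a ≤ A` as a lower
Lebesgue integral. [folklore] -/
theorem ofReal_posPartition_of_measurable (ha : Measurable a) (ha0 : ∀ y, 0 ≤ a y) {A : ℝ}
    (hA : ∀ y, a y ≤ A) (ε : ℝ) (n : ℕ) :
    ENNReal.ofReal (posPartition a ε n) = ∫⁻ x, ENNReal.ofReal (posWeight a ε n x) :=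
  ofReal_integral_eq_lintegral_ofReal
    (integrable_config_of_abs_le (measurable_posWeight_of_measurable ha ε n) (abs_posWeight_le ha0 hA ε))
    (Eventually.of_forall fun x => posWeight_nonneg ha0 ε x)

/-! ### Tilting the activity: the convexity (Jensen) lower bound -/

/-- **The tilted weight**: `posWeight (a e^ψ) = posWeight a · exp(∑ᵢ ψ(xᵢ))`. [folklore] -/
theorem posWeight_mul_exp (a ψ : T3 → ℝ) (ε : ℝ) (n : ℕ) (x : Fin n → T3) :
    posWeight (fun y => a y * Real.exp (ψ y)) ε n x = posWeight a ε n x * Real.exp (∑ i, ψ (x i)) := by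
  unfold posWeight
  by_cases hx : x ∈ posDomain ε n
  · rw [indicator_of_mem hx, indicator_of_mem hx, Finset.prod_mul_distrib, Real.exp_sum]
  · rw [indicator_of_notMem hx, indicator_of_notMem hx, zero_mul]

/-- **Weighted Jensen inequality for the exponential** on a finite measure space: for a weight
`w ≥ 0` of positive mass `Z = ∫ w` and a real `Y` with `w Y` and `w e^Y` integrable,
`Z · exp(Z⁻¹ ∫ w Y) ≤ ∫ w e^Y` (pointwise `e^Y ≥ e^{y₀}(1 + Y − y₀)` at `y₀ = Z⁻¹ ∫ w Y`). [folklore] -/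
theorem mul_exp_le_integral_mul_exp {α : Type*} [MeasurableSpace α] {μ : Measure α}
    {w Y : α → ℝ} (hw0 : ∀ x, 0 ≤ w x) (hwi : Integrable w μ)
    (hwY : Integrable (fun x => w x * Y x) μ) (hweY : Integrable (fun x => w x * Real.exp (Y x)) μ)
    (hZ : 0 < ∫ x, w x ∂μ) :
    (∫ x, w x ∂μ) * Real.exp ((∫ x, w x ∂μ)⁻¹ * ∫ x, w x * Y x ∂μ) ≤
      ∫ x, w x * Real.exp (Y x) ∂μ := by
  set Z := ∫ x, w x ∂μ with hZdef
  set y₀ := Z⁻¹ * ∫ x, w x * Y x ∂μ with hy₀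
  have hZy : ∫ x, w x * Y x ∂μ = Z * y₀ := by
    rw [hy₀, ← mul_assoc, mul_inv_cancel₀ hZ.ne', one_mul]
  have hpt : ∀ x, Real.exp y₀ * (1 - y₀) * w x + Real.exp y₀ * (w x * Y x) ≤ w x * Real.exp (Y x) := by
    intro x
    have h := Real.add_one_le_exp (Y x - y₀)
    have h1 : Real.exp y₀ * (1 + (Y x - y₀)) ≤ Real.exp (Y x) := by
      calc Real.exp y₀ * (1 + (Y x - y₀)) ≤ Real.exp y₀ * Real.exp (Y x - y₀) :=
            mul_le_mul_of_nonneg_left (by linarith) (Real.exp_nonneg _)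
        _ = Real.exp (Y x) := by rw [← Real.exp_add]; ring_nf
    have h2 := mul_le_mul_of_nonneg_left h1 (hw0 x)
    linarith
  have hint : Integrable (fun x => Real.exp y₀ * (1 - y₀) * w x + Real.exp y₀ * (w x * Y x)) μ :=
    (hwi.const_mul _).add (hwY.const_mul _)
  calc Z * Real.exp y₀
      = ∫ x, Real.exp y₀ * (1 - y₀) * w x + Real.exp y₀ * (w x * Y x) ∂μ := by
        rw [integral_add (hwi.const_mul _) (hwY.const_mul _), integral_const_mul, integral_const_mul,
          hZy]
        ring
    _ ≤ _ := integral_mono hint hweY hpt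

/-- **Convexity of the canonical free energy in the field (Jensen's lower bound).** For a
measurable activity `0 ≤ a ≤ A` with `Z(a) > 0` and a bounded measurable tilt `ψ`:
`Z(a)⁻¹ ∫ 𝟙 ∏a · (∑ᵢ ψ(xᵢ)) ≤ log Z(a e^ψ) − log Z(a)`. [folklore] -/
theorem log_posPartition_tilt_ge (ha : Measurable a) (ha0 : ∀ y, 0 ≤ a y) {A : ℝ} (hA : ∀ y, a y ≤ A)
    {ψ : T3 → ℝ} (hψ : Measurable ψ) {C : ℝ} (hψC : ∀ y, |ψ y| ≤ C) (ε : ℝ) (n : ℕ)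
    (hZ : 0 < posPartition a ε n) :
    (posPartition a ε n)⁻¹ * ∫ x, posWeight a ε n x * ∑ i, ψ (x i) ≤
      Real.log (posPartition (fun y => a y * Real.exp (ψ y)) ε n) - Real.log (posPartition a ε n) := by
  have hC : 0 ≤ C := (abs_nonneg _).trans (hψC 0)
  have hwm : Measurable (posWeight a ε n) := measurable_posWeight_of_measurable ha ε n
  have hwi : Integrable (posWeight a ε n) := integrable_config_of_abs_le hwm (abs_posWeight_le ha0 hA ε)
  have hSm : Measurable fun x : Fin n → T3 => ∑ i, ψ (x i) := measurable_sum_apply hψ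
  have hwY : Integrable (fun x => posWeight a ε n x * ∑ i, ψ (x i)) := by
    refine integrable_config_of_abs_le (hwm.mul hSm) (K := A ^ n * (n * C)) fun x => ?_
    rw [abs_mul]
    exact mul_le_mul (abs_posWeight_le ha0 hA ε x) (abs_sum_apply_le' hψC x) (abs_nonneg _)
      (pow_nonneg ((ha0 0).trans (hA 0)) n)
  have hweY : Integrable (fun x => posWeight a ε n x * Real.exp (∑ i, ψ (x i))) := by
    refine integrable_config_of_abs_le (hwm.mul (Real.measurable_exp.comp hSm)) (K := A ^ n * Real.exp (n * C))
      fun x => ?_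
    rw [abs_mul, abs_of_pos (Real.exp_pos _)]
    refine mul_le_mul (abs_posWeight_le ha0 hA ε x) ?_ (Real.exp_nonneg _)
      (pow_nonneg ((ha0 0).trans (hA 0)) n)
    exact Real.exp_le_exp.2 ((le_abs_self _).trans (abs_sum_apply_le' hψC x))
  have hJ := mul_exp_le_integral_mul_exp (fun x => posWeight_nonneg ha0 ε x) hwi hwY hweY hZ
  have hZ' : posPartition (fun y => a y * Real.exp (ψ y)) ε n =
      ∫ x, posWeight a ε n x * Real.exp (∑ i, ψ (x i)) := by
    rw [posPartition]
    exact integral_congr_ae (Eventually.of_forall fun x => posWeight_mul_exp a ψ ε n x)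
  rw [← hZ', ← posPartition] at hJ
  have hpos : 0 < posPartition a ε n * Real.exp ((posPartition a ε n)⁻¹ *
      ∫ x, posWeight a ε n x * ∑ i, ψ (x i)) := mul_pos hZ (Real.exp_pos _)
  have hlog := Real.log_le_log hpos hJ
  rw [Real.log_mul hZ.ne' (Real.exp_pos _).ne', Real.log_exp] at hlog
  linarith

end Summit.AtomisticToContinuum.HydrodynamicLimit.Theorems.HardSphereLDA

end
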